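import Literature.MathematicalPhysics.QuantumFieldTheory.Balaban1983to89.B9Eq373CubeLettersLaplacian

/-!
# `Balaban1983to89.B9Eq377CubeLettersProjection` — [B9] (3.74)–(3.76) p. 405, (3.77) p. 406 AT THE CUBE LETTERS: THE PROJECTION PIECE `D₁R_□(1)D*₁ − D′R_□(U′)D*′` OF THE
# REMAINDER `V(A)` HAS THE ONE-SIDED DIAGONAL BOUND `⟨C, V_R C⟩ ≦ 4√((d+1)c_f²)·(σ + ρ)·‖C‖·⟨C, Δ_{a,□}(1)C⟩^{1/2}` from the bond window `ρ` and ONE displayed number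
# `σ` — the `L²` size of the projection difference `R_□(1) − R_□(U′)` (print's `P₁(A)`, «a non-local bounded operator», (3.76)–(3.77)); with `B9Eq373CubeLettersLaplacian`
# this leaves, on the Theorem-3.11 road for `G_□`, only `σ` and the averaging piece displayed

statement-level skeleton of published theorems with citation tags; proofs where landed; nothing here is a claim about the Yang–Mills mass gap

T. Bałaban, *Propagators for lattice gauge theories in a background field*, Commun. Math. Phys. **99** (1985) 389–434 [`Balaban1985BackgroundPropagators`,
"[B9]"; held text `paper:balaban1985-cmp99-background-propagators`, journal page = PDF page + 388; pp. 404–407 read first-hand].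

THE PRINT (verbatim, p. 405): «(3.74) … = (DD*A′)(x) − (V₂(A)A′)(x), (3.75) … D_{U′U}R(U′U)D*_{U′U} = DRD* − V₂(A) − P₁(A), (3.76)»; p. 407: «The operator P₁(A) was
defined in (3.76). It is a non-local bounded operator and satisfies the bound (3.77).»

WHY THIS FILE.  ✓p622725 `B9Thm311CubeLettersGCoerciveDiag` + `B9Eq373CubeLettersLaplacian` reduce Theorem 3.11 ∕ (3.84)–(3.86) for r05's cube letters to ONE-SIDED diagonal
bounds of the projection and averaging pieces.  Here the PROJECTION piece: by (3.8) adjointness and `R_□` a symmetric idempotent (r05 `RCubeY_parSymY_isSymmTr ∕ _idempotent`),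
`⟨C, (D₁R₁D*₁ − D′R′D*′)C⟩ = ‖R₁D*₁C‖² − ‖R′D*′C‖² ≦ 2‖R₁D*₁C‖·‖R₁D*₁C − R′D*′C‖ ≦ 2‖R₁D*₁C‖·(σ‖D*₁C‖ + ‖(D*₁ − D*′)C‖)` with `‖R₁D*₁C‖² ≦ ⟨C, Δ_{a,□}(1)C⟩` ((3.26) as
forms, r05), `‖D*₁C‖² ≦ 4(d+1)c_f²‖C‖²`, `‖(D*₁ − D*′)C‖² ≦ 4(d+1)c_f²ρ²‖C‖²` (the transporter-difference calculus of `B9Eq373CubeLettersLaplacian` §1 on the divergence, def-Y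
`divY_apply_eq_sum_cdsS`).  The ONE displayed number is `σ` with `‖(R_□(1) − R_□(U′))f‖ ≦ σ‖f‖` — the genuine content of (3.76)–(3.77) (Theorems 3.1∕3.2 for the cube letters).

WHAT IS PROVED (sorry-free; 0 `def`).
* §1 (private: `a² − b² ≦ 2a(a − b)`, `HS` of a finite sum), ★ `sum_dir_trIP_bondCompY`
  (`Σ_μ ‖A_μ‖₁² = ‖A‖₁²`), `sum_dir_trIP_bondCompY_shift`.
* §2 `hs_divY_sub_divY_one_apply_le`, ★ `trIP_divY_sub_divY_one_le` (`‖(D*_{U′} − D*₁)C‖₁² ≦ 4(d+1)c_f²ρ²‖C‖₁²`), `hs_divY_one_apply_le`, ★ `trIP_divY_one_le` (`‖D*₁C‖₁² ≦ 4(d+1)c_f²‖C‖₁²`).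
* §3 `sqrt_trIP_R_le` (`‖R_□(U)g‖ ≦ ‖g‖`), `trIP_R_divY_one_sq_le_energy` (`‖R_□(1)D*₁C‖² ≦ ⟨C, Δ_{a,□}(1)C⟩`), ★★★ `upperDiag_projection_piece`
  (`⟨C, V_R C⟩ ≦ 4√((d+1)c_f²)(σ + ρ)·‖C‖·⟨C, Δ_{a,□}(1)C⟩^{1/2}`, i.e. `(a₂, b₂, e₂) = (0, 4√((d+1)c_f²)(σ+ρ), 0)` for `deltaACubeY_coercive_of_windows`).

HONEST SCOPE.  Finite-lattice Hilbert–Schmidt algebra; `σ` and the windows are displayed hypotheses; r05's member-vs-cube localisation caveat applies; `L²` only; count-neutral;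
NOT a node discharge; no summit ∕ sub-problem claim (rungs R3∕R4 conditional; nothing continuum ∕ OS ∕ mass gap; not Clay).  No `sorry`∕`axiom`∕`instance`∕`notation`; NEW file.
Seat `ym-inputs-p02`, cell `pub/ym-inputs`, 2026-08-28.
-/

namespace Literature.MathematicalPhysics.QuantumFieldTheory.Balaban1983to89.B9Eq377CubeLettersProjection

open B9Thm311ReadingCoords B9Thm311DeltaPrimePos B9Thm31SiteGpBoundsReg335Y Node00 B9CubeLettersBondOpsL0
  B9Thm311AdjointAtLetters B9Thm311AdjointPairs B9Thm311CubeLettersFirstThree B9Thm311CubeLettersGCoercive B9Eq382CubeLetters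
  B9Thm311CubeLettersGCoerciveDiag B9Ineq369CurvatureSmallAtLettersY B9Thm311PosOfPrincipalAtLettersY B9Thm311CoercivePureGaugeAtLettersY
  B9Eq373CubeLettersLaplacian Node00.OpsYNablaBridge
open Literature.MathematicalPhysics.QuantumFieldTheory.Balaban1983to89.B6KLevelCensusIndexV1 (KIdx)
open Literature.MathematicalPhysics.QuantumFieldTheory.Balaban1983to89.B6Cover236MultiLevelBlocks (cubes)
open Literature.MathematicalPhysics.QuantumFieldTheory.Balaban1983to89.B9Eq3132CoerciveVariational (trIP_sub_right)
open Literature.MathematicalPhysics.QuantumFieldTheory.Balaban1983to89.B9Ineq349SiteAdjoint (trIP_comm)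
open Literature.MathematicalPhysics.QuantumFieldTheory.Balaban1983to89.B9Eq39Adjoint (R R_one)
open scoped Matrix

noncomputable section

/-! ## §1 Scalar step; bonds ↔ (site, direction) -/


section HS

variable {N : ℕ}

/-- Cauchy–Schwarz for `HS` of a finite sum: `HS(Σ_{k∈s} X k) ≦ |s|·Σ_{k∈s} HS(X k)`. [folklore] -/
private theorem hs_finset_sum_le_card_mul {ι : Type} (s : Finset ι) (X : ι → Matrix (Fin N) (Fin N) ℂ) :
    ∑ a, ∑ b, ‖(∑ k ∈ s, X k) a b‖ ^ 2 ≤ (s.card : ℝ) * ∑ k ∈ s, ∑ a, ∑ b, ‖X k a b‖ ^ 2 := by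
  calc ∑ a, ∑ b, ‖(∑ k ∈ s, X k) a b‖ ^ 2 ≤ ∑ a, ∑ b, (∑ k ∈ s, ‖X k a b‖) ^ 2 := by
        refine Finset.sum_le_sum fun a _ => Finset.sum_le_sum fun b _ => ?_
        rw [Matrix.sum_apply]
        exact pow_le_pow_left₀ (norm_nonneg _) (norm_sum_le _ _) 2
    _ ≤ ∑ a, ∑ b, ((s.card : ℝ) * ∑ k ∈ s, ‖X k a b‖ ^ 2) :=
        Finset.sum_le_sum fun a _ => Finset.sum_le_sum fun b _ => sq_sum_le_card_mul_sum_sq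
    _ = (s.card : ℝ) * ∑ k ∈ s, ∑ a, ∑ b, ‖X k a b‖ ^ 2 := by
        have h1 : ∑ a : Fin N, ∑ b : Fin N, ((s.card : ℝ) * ∑ k ∈ s, ‖X k a b‖ ^ 2) =
            (s.card : ℝ) * ∑ a : Fin N, ∑ b : Fin N, ∑ k ∈ s, ‖X k a b‖ ^ 2 := by
          rw [Finset.mul_sum]; exact Finset.sum_congr rfl fun a _ => by rw [Finset.mul_sum]
        have h2 : ∑ a : Fin N, ∑ b : Fin N, ∑ k ∈ s, ‖X k a b‖ ^ 2 = ∑ k ∈ s, ∑ a : Fin N, ∑ b : Fin N, ‖X k a b‖ ^ 2 :=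
          calc ∑ a : Fin N, ∑ b : Fin N, ∑ k ∈ s, ‖X k a b‖ ^ 2 = ∑ a : Fin N, ∑ k ∈ s, ∑ b : Fin N, ‖X k a b‖ ^ 2 :=
                Finset.sum_congr rfl fun a _ => Finset.sum_comm
            _ = ∑ k ∈ s, ∑ a : Fin N, ∑ b : Fin N, ‖X k a b‖ ^ 2 := Finset.sum_comm
        rw [h1, h2]

end HS

/-- `a² − b² = 2a(a − b) − (a − b)² ≦ 2a(a − b)`. [folklore] -/
private theorem sq_sub_sq_le (a b : ℝ) : a ^ 2 - b ^ 2 ≤ 2 * a * (a - b) := by nlinarith [sq_nonneg (a - b)]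

section Bonds

open scoped Matrix.Norms.L2Operator

variable {d ℓ : ℕ} {hd : 1 ≤ d + 1} {hL : Odd (ℓ + 1) ∧ 1 < ℓ + 1} {b₀ b₁ : ℝ} {N : ℕ}
variable (i : KIdx d ℓ hd hL b₀ b₁)

/-- ★ `Σ_μ ‖A_μ‖₁² = ‖A‖₁²`: the direction components `A_μ = bondCompY μ A` partition the bond carrier (the map `(w, μ) ↦` the bond from `w` in direction `μ`
on def-Y's chart is a bijection `SiteY × Fin (d+1) → FBondY`). [cite: Balaban1985BackgroundPropagators, p.391 (A_μ(x) = A(x, x + ηe_μ)), bookkeeping] -/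
theorem sum_dir_trIP_bondCompY (A : FBondY i → Matrix (Fin N) (Fin N) ℂ) :
    ∑ μ : Fin (d + 1), trIP (fun _ => (1 : ℝ)) (bondCompY i μ A) (bondCompY i μ A) = trIP (fun _ => (1 : ℝ)) A A := by
  simp_rw [trIP_one_self_eq, bondCompY_apply]
  rw [Finset.sum_comm, ← Fintype.sum_prod_type']
  refine Fintype.sum_bijective (fun p : SiteY i × Fin (d + 1) => (⟨(chartY i).symm p.1, p.2⟩ : FBondY i)) ⟨?_, ?_⟩ _ _ (fun _ => rfl)
  · rintro ⟨w, μ⟩ ⟨w', μ'⟩ h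
    have h1 := congrArg PBond.src h
    have h2 := congrArg PBond.dir h
    simp only at h1 h2
    exact Prod.ext ((chartY i).symm.injective h1) h2
  · intro b
    exact ⟨(chartY i b.src, b.dir), by obtain ⟨s, μ⟩ := b; exact congrArg (fun t => (⟨t, μ⟩ : FBondY i)) ((chartY i).symm_apply_apply s)⟩

/-- the same with each component read after the shift `z ↦ z − e_μ` (a permutation of the sites). [cite: Balaban1985BackgroundPropagators, p.391, bookkeeping] -/
theorem sum_dir_trIP_bondCompY_shift (A : FBondY i → Matrix (Fin N) (Fin N) ℂ) :
    ∑ μ : Fin (d + 1), ∑ z : SiteY i, ∑ a, ∑ b, ‖bondCompY i μ A ((shiftY i μ).symm z) a b‖ ^ 2 = trIP (fun _ => (1 : ℝ)) A A := by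
  rw [← sum_dir_trIP_bondCompY i A]
  refine Finset.sum_congr rfl fun μ _ => ?_
  rw [trIP_one_self_eq]
  exact (shiftY i μ).symm.sum_comp (fun z => ∑ a, ∑ b, ‖bondCompY i μ A z a b‖ ^ 2)

end Bonds

/-! ## §2 The divergence: size at `U = 1`, and its motion under the bond window -/

section Divergence

open scoped Matrix.Norms.L2Operator

variable {d ℓ : ℕ} {hd : 1 ≤ d + 1} {hL : Odd (ℓ + 1) ∧ 1 < ℓ + 1} {b₀ b₁ : ℝ} {N : ℕ}
variable (i : KIdx d ℓ hd hL b₀ b₁) {U : CfgY (Matrix (Fin N) (Fin N) ℂ) i}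

/-- pointwise: `HS((D*_{U′}C − D*₁C)(z)) ≦ 4(d+1)c_f²ρ²·Σ_μ HS(C_μ(z − e_μ))` (one transporter per incoming bond moves).
[cite: Balaban1985BackgroundPropagators, (3.74) p.405, (3.8) p.392] -/
theorem hs_divY_sub_divY_one_apply_le
    (hU : ∀ μ x, ((U μ x : (Matrix (Fin N) (Fin N) ℂ)ˣ) : Matrix (Fin N) (Fin N) ℂ) ∈ unitary (Matrix (Fin N) (Fin N) ℂ)) {ρ : ℝ}
    (hρ : ∀ μ x, ‖((U μ x : (Matrix (Fin N) (Fin N) ℂ)ˣ) : Matrix (Fin N) (Fin N) ℂ) - 1‖ ≤ ρ)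
    (C : FBondY i → Matrix (Fin N) (Fin N) ℂ) (z : SiteY i) :
    ∑ a, ∑ b, ‖(divY i U C - divY i (fun _ _ => 1 : CfgY (Matrix (Fin N) (Fin N) ℂ) i) C) z a b‖ ^ 2 ≤
      4 * (d + 1) * i.cf ^ 2 * ρ ^ 2 * ∑ μ : Fin (d + 1), ∑ a, ∑ b, ‖bondCompY i μ C ((shiftY i μ).symm z) a b‖ ^ 2 := by
  have hcf : ‖((i.cf : ℝ) : ℂ)‖ ^ 2 = i.cf ^ 2 := by rw [Complex.norm_real, Real.norm_eq_abs, sq_abs]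
  have hdiff : (divY i U C - divY i (fun _ _ => 1 : CfgY (Matrix (Fin N) (Fin N) ℂ) i) C) z =
      ((i.cf : ℝ) : ℂ) • ∑ μ : Fin (d + 1),
        (R (U μ ((chartY i).symm ((shiftY i μ).symm z)))⁻¹ (bondCompY i μ C ((shiftY i μ).symm z)) - bondCompY i μ C ((shiftY i μ).symm z)) := by
    rw [Pi.sub_apply, divY_apply_eq_sum_cdsS, divY_apply_eq_sum_cdsS, ← smul_sub, ← Finset.sum_sub_distrib]
    congr 1
    refine Finset.sum_congr rfl fun μ _ => ?_
    rw [cdsS_apply, cdsS_one]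
    abel
  rw [hdiff, hs_smul, hcf]
  have hterm : ∀ μ : Fin (d + 1),
      ∑ a, ∑ b, ‖(R (U μ ((chartY i).symm ((shiftY i μ).symm z)))⁻¹ (bondCompY i μ C ((shiftY i μ).symm z)) -
        bondCompY i μ C ((shiftY i μ).symm z)) a b‖ ^ 2 ≤ 4 * ρ ^ 2 * ∑ a, ∑ b, ‖bondCompY i μ C ((shiftY i μ).symm z) a b‖ ^ 2 := by
    intro μ
    have hV := hU μ ((chartY i).symm ((shiftY i μ).symm z))
    have hVi : (((U μ ((chartY i).symm ((shiftY i μ).symm z)))⁻¹ : (Matrix (Fin N) (Fin N) ℂ)ˣ) : Matrix (Fin N) (Fin N) ℂ) ∈ unitary _ := by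
      rw [val_inv_eq_conjTranspose _ hV, ← Matrix.star_eq_conjTranspose]; exact Unitary.star_mem hV
    exact hs_R_sub_self_le hVi (norm_inv_sub_one_le hV (hρ μ _)) _
  have hsum := hs_finset_sum_le_card_mul (Finset.univ : Finset (Fin (d + 1)))
    (fun μ => R (U μ ((chartY i).symm ((shiftY i μ).symm z)))⁻¹ (bondCompY i μ C ((shiftY i μ).symm z)) - bondCompY i μ C ((shiftY i μ).symm z))
  rw [Finset.card_univ, Fintype.card_fin] at hsum
  have h2 := Finset.sum_le_sum fun μ (_ : μ ∈ Finset.univ) => hterm μ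
  rw [← Finset.mul_sum] at h2
  have hc2 : 0 ≤ i.cf ^ 2 := sq_nonneg _
  calc i.cf ^ 2 * ∑ a, ∑ b, ‖(∑ μ : Fin (d + 1), (R (U μ ((chartY i).symm ((shiftY i μ).symm z)))⁻¹ (bondCompY i μ C ((shiftY i μ).symm z)) -
          bondCompY i μ C ((shiftY i μ).symm z))) a b‖ ^ 2
      ≤ i.cf ^ 2 * (((d + 1 : ℕ) : ℝ) * (4 * ρ ^ 2 * ∑ μ : Fin (d + 1), ∑ a, ∑ b, ‖bondCompY i μ C ((shiftY i μ).symm z) a b‖ ^ 2)) := by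
        refine mul_le_mul_of_nonneg_left (le_trans ?_ (mul_le_mul_of_nonneg_left h2 (by positivity))) hc2
        simpa [Finset.sum_apply] using hsum
    _ = 4 * (d + 1) * i.cf ^ 2 * ρ ^ 2 * ∑ μ : Fin (d + 1), ∑ a, ∑ b, ‖bondCompY i μ C ((shiftY i μ).symm z) a b‖ ^ 2 := by push_cast; ring

/-- ★ **IN `L²`**: `‖(D*_{U′} − D*₁)C‖₁² ≦ 4(d+1)c_f²ρ²·‖C‖₁²`. [cite: Balaban1985BackgroundPropagators, (3.74)–(3.75) p.405] -/
theorem trIP_divY_sub_divY_one_le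
    (hU : ∀ μ x, ((U μ x : (Matrix (Fin N) (Fin N) ℂ)ˣ) : Matrix (Fin N) (Fin N) ℂ) ∈ unitary (Matrix (Fin N) (Fin N) ℂ)) {ρ : ℝ}
    (hρ : ∀ μ x, ‖((U μ x : (Matrix (Fin N) (Fin N) ℂ)ˣ) : Matrix (Fin N) (Fin N) ℂ) - 1‖ ≤ ρ)
    (C : FBondY i → Matrix (Fin N) (Fin N) ℂ) :
    trIP (fun _ => (1 : ℝ)) (divY i U C - divY i (fun _ _ => 1 : CfgY (Matrix (Fin N) (Fin N) ℂ) i) C)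
        (divY i U C - divY i (fun _ _ => 1 : CfgY (Matrix (Fin N) (Fin N) ℂ) i) C) ≤
      4 * (d + 1) * i.cf ^ 2 * ρ ^ 2 * trIP (fun _ => (1 : ℝ)) C C := by
  rw [trIP_one_self_eq, ← sum_dir_trIP_bondCompY_shift i C]
  have h1 := Finset.sum_le_sum fun z (_ : z ∈ Finset.univ) => hs_divY_sub_divY_one_apply_le i hU hρ C z
  calc _ ≤ ∑ z : SiteY i, 4 * (d + 1) * i.cf ^ 2 * ρ ^ 2 * ∑ μ : Fin (d + 1), ∑ a, ∑ b, ‖bondCompY i μ C ((shiftY i μ).symm z) a b‖ ^ 2 := h1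
    _ = 4 * (d + 1) * i.cf ^ 2 * ρ ^ 2 * ∑ μ : Fin (d + 1), ∑ z : SiteY i, ∑ a, ∑ b, ‖bondCompY i μ C ((shiftY i μ).symm z) a b‖ ^ 2 := by
        rw [← Finset.mul_sum, Finset.sum_comm]

/-- pointwise at `U = 1`: `HS((D*₁C)(z)) ≦ 2(d+1)c_f²·Σ_μ (HS(C_μ(z − e_μ)) + HS(C_μ(z)))`. [cite: Balaban1985BackgroundPropagators, (3.8) p.392; folklore] -/
theorem hs_divY_one_apply_le (C : FBondY i → Matrix (Fin N) (Fin N) ℂ) (z : SiteY i) :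
    ∑ a, ∑ b, ‖divY i (fun _ _ => 1 : CfgY (Matrix (Fin N) (Fin N) ℂ) i) C z a b‖ ^ 2 ≤
      2 * (d + 1) * i.cf ^ 2 * ∑ μ : Fin (d + 1), (∑ a, ∑ b, ‖bondCompY i μ C ((shiftY i μ).symm z) a b‖ ^ 2 +
        ∑ a, ∑ b, ‖bondCompY i μ C z a b‖ ^ 2) := by
  have hcf : ‖((i.cf : ℝ) : ℂ)‖ ^ 2 = i.cf ^ 2 := by rw [Complex.norm_real, Real.norm_eq_abs, sq_abs]
  rw [divY_apply_eq_sum_cdsS, hs_smul, hcf]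
  simp_rw [cdsS_one]
  have hsum := hs_finset_sum_le_card_mul (Finset.univ : Finset (Fin (d + 1)))
    (fun μ => bondCompY i μ C ((shiftY i μ).symm z) - bondCompY i μ C z)
  rw [Finset.card_univ, Fintype.card_fin] at hsum
  have h2 := Finset.sum_le_sum fun μ (_ : μ ∈ (Finset.univ : Finset (Fin (d + 1)))) =>
    hs_sub_le (bondCompY i μ C ((shiftY i μ).symm z)) (bondCompY i μ C z)
  have hc2 : 0 ≤ i.cf ^ 2 := sq_nonneg _
  calc i.cf ^ 2 * ∑ a, ∑ b, ‖(∑ μ : Fin (d + 1), (bondCompY i μ C ((shiftY i μ).symm z) - bondCompY i μ C z)) a b‖ ^ 2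
      ≤ i.cf ^ 2 * (((d + 1 : ℕ) : ℝ) * ∑ μ : Fin (d + 1), (2 * ∑ a, ∑ b, ‖bondCompY i μ C ((shiftY i μ).symm z) a b‖ ^ 2 +
          2 * ∑ a, ∑ b, ‖bondCompY i μ C z a b‖ ^ 2)) := by
        refine mul_le_mul_of_nonneg_left (le_trans ?_ (mul_le_mul_of_nonneg_left h2 (by positivity))) hc2
        simpa [Finset.sum_apply] using hsum
    _ = 2 * (d + 1) * i.cf ^ 2 * ∑ μ : Fin (d + 1), (∑ a, ∑ b, ‖bondCompY i μ C ((shiftY i μ).symm z) a b‖ ^ 2 +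
        ∑ a, ∑ b, ‖bondCompY i μ C z a b‖ ^ 2) := by
          have h3 : ∑ μ : Fin (d + 1), (2 * ∑ a, ∑ b, ‖bondCompY i μ C ((shiftY i μ).symm z) a b‖ ^ 2 +
              2 * ∑ a, ∑ b, ‖bondCompY i μ C z a b‖ ^ 2) =
              2 * ∑ μ : Fin (d + 1), (∑ a, ∑ b, ‖bondCompY i μ C ((shiftY i μ).symm z) a b‖ ^ 2 + ∑ a, ∑ b, ‖bondCompY i μ C z a b‖ ^ 2) := by
            rw [Finset.mul_sum]; exact Finset.sum_congr rfl fun μ _ => by ring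
          rw [h3]; push_cast; ring

/-- ★ **`‖D*₁C‖₁² ≦ 4(d+1)c_f²·‖C‖₁²`** (each bond meets two sites). [cite: Balaban1985BackgroundPropagators, (3.8) p.392; folklore] -/
theorem trIP_divY_one_le (C : FBondY i → Matrix (Fin N) (Fin N) ℂ) :
    trIP (fun _ => (1 : ℝ)) (divY i (fun _ _ => 1 : CfgY (Matrix (Fin N) (Fin N) ℂ) i) C) (divY i (fun _ _ => 1 : CfgY (Matrix (Fin N) (Fin N) ℂ) i) C) ≤
      4 * (d + 1) * i.cf ^ 2 * trIP (fun _ => (1 : ℝ)) C C := by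
  rw [trIP_one_self_eq]
  have h1 := Finset.sum_le_sum fun z (_ : z ∈ Finset.univ) => hs_divY_one_apply_le i C z
  rw [← Finset.mul_sum] at h1
  have hA : ∑ z : SiteY i, ∑ μ : Fin (d + 1), (∑ a, ∑ b, ‖bondCompY i μ C ((shiftY i μ).symm z) a b‖ ^ 2 +
      ∑ a, ∑ b, ‖bondCompY i μ C z a b‖ ^ 2) = 2 * trIP (fun _ => (1 : ℝ)) C C := by
    rw [Finset.sum_comm]
    simp_rw [Finset.sum_add_distrib]
    have h2 : ∑ μ : Fin (d + 1), ∑ z : SiteY i, ∑ a, ∑ b, ‖bondCompY i μ C z a b‖ ^ 2 = trIP (fun _ => (1 : ℝ)) C C := by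
      rw [← sum_dir_trIP_bondCompY i C]
      exact Finset.sum_congr rfl fun μ _ => (trIP_one_self_eq _).symm
    rw [sum_dir_trIP_bondCompY_shift i C, h2]; ring
  rw [hA] at h1
  linarith

end Divergence

/-! ## §3 The projection piece -/

section Projection

open scoped Matrix.Norms.L2Operator

variable {d ℓ : ℕ} {hd : 1 ≤ d + 1} {hL : Odd (ℓ + 1) ∧ 1 < ℓ + 1} {b₀ b₁ : ℝ} {N : ℕ}
variable (i : KIdx d ℓ hd hL b₀ b₁) (q : ↥(cubes (toKT i).D.toDomains)) {G : Subgroup (Matrix (Fin N) (Fin N) ℂ)ˣ}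

/-- `‖R_□(U)g‖ ≦ ‖g‖` for the symmetric idempotent `R_□(U)` (`G`-valued `U`, `G ≦ U(N)`). [cite: Balaban1985BackgroundPropagators, (3.25) p.394 (R a projection)] -/
theorem sqrt_trIP_R_le (hG : G ≤ B7Prop2Explicit.unitaryUnits (Matrix (Fin N) (Fin N) ℂ)) {U : CfgY (Matrix (Fin N) (Fin N) ℂ) i} (hU : ∀ μ x, U μ x ∈ G)
    (g : SiteY i → Matrix (Fin N) (Fin N) ℂ) :
    Real.sqrt (trIP (fun _ => (1 : ℝ)) (RCubeY i q (parSymY i) U g) (RCubeY i q (parSymY i) U g)) ≤ Real.sqrt (trIP (fun _ => (1 : ℝ)) g g) := by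
  have hw : ∀ _ : SiteY i, (0 : ℝ) < 1 := fun _ => one_pos
  set r := RCubeY i q (parSymY i) U g
  have hsq := trIP_RCubeY_parSymY_self i q hG hU g   -- ⟨g, Rg⟩ = ⟨Rg, Rg⟩
  have hcs : trIP (fun _ => (1 : ℝ)) g r ≤ Real.sqrt (trIP (fun _ => (1 : ℝ)) g g) * Real.sqrt (trIP (fun _ => (1 : ℝ)) r r) :=
    le_trans (le_abs_self _) (abs_trIP_le _ hw g r)
  have hr0 : 0 ≤ trIP (fun _ => (1 : ℝ)) r r := trIP_self_nonneg _ hw _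
  have hrr : Real.sqrt (trIP (fun _ => (1 : ℝ)) r r) * Real.sqrt (trIP (fun _ => (1 : ℝ)) r r) = trIP (fun _ => (1 : ℝ)) r r :=
    Real.mul_self_sqrt hr0
  by_cases h0 : Real.sqrt (trIP (fun _ => (1 : ℝ)) r r) = 0
  · rw [h0]; exact Real.sqrt_nonneg _
  · have hpos : 0 < Real.sqrt (trIP (fun _ => (1 : ℝ)) r r) := lt_of_le_of_ne (Real.sqrt_nonneg _) (Ne.symm h0)
    have h1 : Real.sqrt (trIP (fun _ => (1 : ℝ)) r r) * Real.sqrt (trIP (fun _ => (1 : ℝ)) r r) ≤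
        Real.sqrt (trIP (fun _ => (1 : ℝ)) g g) * Real.sqrt (trIP (fun _ => (1 : ℝ)) r r) := by
      calc Real.sqrt (trIP (fun _ => (1 : ℝ)) r r) * Real.sqrt (trIP (fun _ => (1 : ℝ)) r r) = trIP (fun _ => (1 : ℝ)) r r := hrr
        _ = trIP (fun _ => (1 : ℝ)) g r := hsq.symm
        _ ≤ _ := hcs
    exact le_of_mul_le_mul_right h1 hpos

/-- `‖R_□(1)D*₁C‖² ≦ ⟨C, Δ_{a,□}(1)C⟩` ((3.26) as forms at the cube letters, r05's `trIP_deltaACubeY_parSymY_eq`; the other two forms are squares). [cite: Balaban1985BackgroundPropagators, (3.26) p.395] -/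
theorem trIP_R_divY_one_sq_le_energy (hb₀ : 0 < b₀) (C : FBondY i → Matrix (Fin N) (Fin N) ℂ) :
    trIP (fun _ => (1 : ℝ))
        (RCubeY i q (parSymY i) (fun _ _ => 1 : CfgY (Matrix (Fin N) (Fin N) ℂ) i) (divY i (fun _ _ => 1 : CfgY (Matrix (Fin N) (Fin N) ℂ) i) C))
        (RCubeY i q (parSymY i) (fun _ _ => 1 : CfgY (Matrix (Fin N) (Fin N) ℂ) i) (divY i (fun _ _ => 1 : CfgY (Matrix (Fin N) (Fin N) ℂ) i) C)) ≤
      trIP (fun _ => (1 : ℝ)) C (deltaACubeY i q (parSymY i) (parBY i) (fun _ _ => 1 : CfgY (Matrix (Fin N) (Fin N) ℂ) i) C) := by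
  have hG1 : (B7Prop2Explicit.unitaryUnits (Matrix (Fin N) (Fin N) ℂ)) ≤ B7Prop2Explicit.unitaryUnits (Matrix (Fin N) (Fin N) ℂ) := le_rfl
  have hU1 : ∀ μ x, ((fun _ _ => 1 : CfgY (Matrix (Fin N) (Fin N) ℂ) i) μ x) ∈ B7Prop2Explicit.unitaryUnits (Matrix (Fin N) (Fin N) ℂ) :=
    fun _ _ => Subgroup.one_mem _
  rw [trIP_deltaACubeY_parSymY_eq i q hG1 hU1 C, ← trIP_RCubeY_parSymY_self i q hG1 hU1]
  have hH : 0 ≤ trIP (fun _ => (1 : ℝ)) C (hessY i (fun _ _ => 1 : CfgY (Matrix (Fin N) (Fin N) ℂ) i) C) := by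
    rw [trIP_hessY_eq_curl_of_flat i (fun _ _ => by simp) (fun p => holY_one i p) C]
    exact trIP_self_nonneg _ (fun _ => one_pos) _
  have hQ : 0 ≤ trIP (B9CubeBondWeights.wCubeBond i q) (QCubeY i q (parBY i) (fun _ _ => 1 : CfgY (Matrix (Fin N) (Fin N) ℂ) i) C)
      (QCubeY i q (parBY i) (fun _ _ => 1 : CfgY (Matrix (Fin N) (Fin N) ℂ) i) C) := trIP_self_nonneg _ (B9CubeBondWeights.wCubeBond_pos i q hb₀) _
  linarith

/-- ★★★ **THE PROJECTION PIECE OF `V(A)`, ONE-SIDED DIAGONAL BOUND**: at def-Y's v4 transporters (`0 < b₀`), for a `G`-valued `U′` (`G ≦ U(N)`) with bond window `ρ ≧ 0` and a number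
`σ ≧ 0` with `‖(R_□(1) − R_□(U′))f‖ ≦ σ‖f‖` for all site functions `f` (DISPLAYED — print's `P₁(A)`, (3.76)–(3.77)):
`⟨C, (D₁R_□(1)D*₁ − D_{U′}R_□(U′)D*_{U′})C⟩ ≦ 4√((d+1)c_f²)·(σ + ρ)·‖C‖·⟨C, Δ_{a,□}(1)C⟩^{1/2}` — the `(a₂, b₂, e₂) = (0, 4√((d+1)c_f²)(σ+ρ), 0)` summand of
`B9Eq373CubeLettersLaplacian.deltaACubeY_coercive_of_windows`. [cite: Balaban1985BackgroundPropagators, (3.74)–(3.76) p.405, (3.77) p.406, (3.84) p.407, Thm 3.11 p.416] -/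
theorem upperDiag_projection_piece (hb₀ : 0 < b₀) (hG : G ≤ B7Prop2Explicit.unitaryUnits (Matrix (Fin N) (Fin N) ℂ))
    {U : CfgY (Matrix (Fin N) (Fin N) ℂ) i} (hU : ∀ μ x, U μ x ∈ G) {ρ σ : ℝ} (hρ0 : 0 ≤ ρ) (hσ0 : 0 ≤ σ)
    (hρ : ∀ μ x, ‖((U μ x : (Matrix (Fin N) (Fin N) ℂ)ˣ) : Matrix (Fin N) (Fin N) ℂ) - 1‖ ≤ ρ)
    (hσ : ∀ f : SiteY i → Matrix (Fin N) (Fin N) ℂ,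
      Real.sqrt (trIP (fun _ => (1 : ℝ))
        ((RCubeY i q (parSymY i) (fun _ _ => 1 : CfgY (Matrix (Fin N) (Fin N) ℂ) i) - RCubeY i q (parSymY i) U) f)
        ((RCubeY i q (parSymY i) (fun _ _ => 1 : CfgY (Matrix (Fin N) (Fin N) ℂ) i) - RCubeY i q (parSymY i) U) f)) ≤
      σ * Real.sqrt (trIP (fun _ => (1 : ℝ)) f f))
    (C : FBondY i → Matrix (Fin N) (Fin N) ℂ) :
    trIP (fun _ => (1 : ℝ)) C
        ((gradY i (fun _ _ => 1 : CfgY (Matrix (Fin N) (Fin N) ℂ) i) ∘ₗ RCubeY i q (parSymY i) (fun _ _ => 1 : CfgY (Matrix (Fin N) (Fin N) ℂ) i) ∘ₗ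
              divY i (fun _ _ => 1 : CfgY (Matrix (Fin N) (Fin N) ℂ) i) -
            gradY i U ∘ₗ RCubeY i q (parSymY i) U ∘ₗ divY i U) C) ≤
      0 * trIP (fun _ => (1 : ℝ)) C C +
        4 * Real.sqrt ((d + 1) * i.cf ^ 2) * (σ + ρ) * Real.sqrt (trIP (fun _ => (1 : ℝ)) C C) *
          Real.sqrt (trIP (fun _ => (1 : ℝ)) C (deltaACubeY i q (parSymY i) (parBY i) (fun _ _ => 1 : CfgY (Matrix (Fin N) (Fin N) ℂ) i) C)) +
        0 * trIP (fun _ => (1 : ℝ)) C (deltaACubeY i q (parSymY i) (parBY i) (fun _ _ => 1 : CfgY (Matrix (Fin N) (Fin N) ℂ) i) C) := by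
  have hw : ∀ _ : SiteY i, (0 : ℝ) < 1 := fun _ => one_pos
  have hwb : ∀ _ : FBondY i, (0 : ℝ) < 1 := fun _ => one_pos
  have hU' : ∀ μ x, ((U μ x : (Matrix (Fin N) (Fin N) ℂ)ˣ) : Matrix (Fin N) (Fin N) ℂ) ∈ unitary (Matrix (Fin N) (Fin N) ℂ) := fun μ x => hG (hU μ x)
  have hG1 : (B7Prop2Explicit.unitaryUnits (Matrix (Fin N) (Fin N) ℂ)) ≤ B7Prop2Explicit.unitaryUnits (Matrix (Fin N) (Fin N) ℂ) := le_rfl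
  have hU1 : ∀ μ x, ((fun _ _ => 1 : CfgY (Matrix (Fin N) (Fin N) ℂ) i) μ x) ∈ B7Prop2Explicit.unitaryUnits (Matrix (Fin N) (Fin N) ℂ) :=
    fun _ _ => Subgroup.one_mem _
  have hU1' : ∀ μ x, (((fun _ _ => 1 : CfgY (Matrix (Fin N) (Fin N) ℂ) i) μ x : (Matrix (Fin N) (Fin N) ℂ)ˣ) : Matrix (Fin N) (Fin N) ℂ) ∈ unitary _ :=
    fun _ _ => by simp
  -- names
  set f₀ := divY i (fun _ _ => 1 : CfgY (Matrix (Fin N) (Fin N) ℂ) i) C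
  set f' := divY i U C
  set R₀ := RCubeY i q (parSymY i) (fun _ _ => 1 : CfgY (Matrix (Fin N) (Fin N) ℂ) i)
  set R' := RCubeY i q (parSymY i) U
  -- the form as a difference of two squares
  have hform : trIP (fun _ => (1 : ℝ)) C
      ((gradY i (fun _ _ => 1 : CfgY (Matrix (Fin N) (Fin N) ℂ) i) ∘ₗ R₀ ∘ₗ divY i (fun _ _ => 1 : CfgY (Matrix (Fin N) (Fin N) ℂ) i) -
        gradY i U ∘ₗ R' ∘ₗ divY i U) C) =
      trIP (fun _ => (1 : ℝ)) (R₀ f₀) (R₀ f₀) - trIP (fun _ => (1 : ℝ)) (R' f') (R' f') := by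
    rw [LinearMap.sub_apply, trIP_sub_right, LinearMap.comp_apply, LinearMap.comp_apply, LinearMap.comp_apply, LinearMap.comp_apply,
      trIP_comm (fun _ => (1 : ℝ)) C, isAdjTr_gradY_divY i _ hU1', trIP_comm (fun _ => (1 : ℝ)) (R₀ _),
      trIP_comm (fun _ => (1 : ℝ)) C, isAdjTr_gradY_divY i U hU', trIP_comm (fun _ => (1 : ℝ)) (R' _),
      trIP_RCubeY_parSymY_self i q hG1 hU1, trIP_RCubeY_parSymY_self i q hG hU]
  -- sizes (generalised names to keep the arithmetic light)
  have ha0 : 0 ≤ trIP (fun _ => (1 : ℝ)) (R₀ f₀) (R₀ f₀) := trIP_self_nonneg _ hw _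
  have hb0 : 0 ≤ trIP (fun _ => (1 : ℝ)) (R' f') (R' f') := trIP_self_nonneg _ hw _
  have hC0 : 0 ≤ trIP (fun _ => (1 : ℝ)) C C := trIP_self_nonneg _ hwb _
  have hκ0 : 0 ≤ (d + 1 : ℝ) * i.cf ^ 2 := by positivity
  -- `a ≦ b + ‖R₀f₀ − R′f′‖`
  have htri : Real.sqrt (trIP (fun _ => (1 : ℝ)) (R₀ f₀) (R₀ f₀)) ≤
      Real.sqrt (trIP (fun _ => (1 : ℝ)) (R' f') (R' f')) + Real.sqrt (trIP (fun _ => (1 : ℝ)) (R₀ f₀ - R' f') (R₀ f₀ - R' f')) := by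
    have h1 : R₀ f₀ = R' f' + (R₀ f₀ - R' f') := by abel
    have h2 := sqrt_trIP_add_self_le hw (R' f') (R₀ f₀ - R' f')
    rw [← h1] at h2; exact h2
  have hsplit : R₀ f₀ - R' f' = (R₀ - R') f₀ + R' (f₀ - f') := by rw [LinearMap.sub_apply, map_sub]; abel
  have hdiff : Real.sqrt (trIP (fun _ => (1 : ℝ)) (R₀ f₀ - R' f') (R₀ f₀ - R' f')) ≤
      σ * Real.sqrt (trIP (fun _ => (1 : ℝ)) f₀ f₀) + Real.sqrt (trIP (fun _ => (1 : ℝ)) (f₀ - f') (f₀ - f')) := by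
    rw [hsplit]
    exact le_trans (sqrt_trIP_add_self_le hw _ _) (add_le_add (hσ f₀) (sqrt_trIP_R_le i q hG hU (f₀ - f')))
  -- `‖f₀‖ ≦ 2√((d+1)c_f²)‖C‖`, `‖f₀ − f′‖ ≦ 2√((d+1)c_f²)ρ‖C‖`
  have hK : 0 ≤ 2 * Real.sqrt ((d + 1) * i.cf ^ 2) * Real.sqrt (trIP (fun _ => (1 : ℝ)) C C) := by positivity
  have hf0 : Real.sqrt (trIP (fun _ => (1 : ℝ)) f₀ f₀) ≤ 2 * Real.sqrt ((d + 1) * i.cf ^ 2) * Real.sqrt (trIP (fun _ => (1 : ℝ)) C C) := by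
    rw [← Real.sqrt_sq hK]
    refine Real.sqrt_le_sqrt ?_
    rw [mul_pow, mul_pow, Real.sq_sqrt hκ0, Real.sq_sqrt hC0]
    have := trIP_divY_one_le i C
    linarith
  have hKρ : 0 ≤ 2 * Real.sqrt ((d + 1) * i.cf ^ 2) * ρ * Real.sqrt (trIP (fun _ => (1 : ℝ)) C C) := by positivity
  have hf1 : Real.sqrt (trIP (fun _ => (1 : ℝ)) (f₀ - f') (f₀ - f')) ≤ 2 * Real.sqrt ((d + 1) * i.cf ^ 2) * ρ * Real.sqrt (trIP (fun _ => (1 : ℝ)) C C) := by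
    have hneg : trIP (fun _ => (1 : ℝ)) (f₀ - f') (f₀ - f') = trIP (fun _ => (1 : ℝ)) (f' - f₀) (f' - f₀) := by rw [← neg_sub f' f₀, trIP_neg_neg]
    rw [hneg, ← Real.sqrt_sq hKρ]
    refine Real.sqrt_le_sqrt ?_
    rw [mul_pow, mul_pow, mul_pow, Real.sq_sqrt hκ0, Real.sq_sqrt hC0]
    have := trIP_divY_sub_divY_one_le i hU' hρ C
    linarith
  -- `a ≦ √E`
  have haE : Real.sqrt (trIP (fun _ => (1 : ℝ)) (R₀ f₀) (R₀ f₀)) ≤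
      Real.sqrt (trIP (fun _ => (1 : ℝ)) C (deltaACubeY i q (parSymY i) (parBY i) (fun _ _ => 1 : CfgY (Matrix (Fin N) (Fin N) ℂ) i) C)) :=
    Real.sqrt_le_sqrt (trIP_R_divY_one_sq_le_energy i q hb₀ C)
  rw [hform, zero_mul, zero_mul, zero_add, add_zero]
  -- abstract the five sizes
  generalize ha : Real.sqrt (trIP (fun _ => (1 : ℝ)) (R₀ f₀) (R₀ f₀)) = a at *
  generalize hb : Real.sqrt (trIP (fun _ => (1 : ℝ)) (R' f') (R' f')) = b at *
  generalize ht : Real.sqrt (trIP (fun _ => (1 : ℝ)) (R₀ f₀ - R' f') (R₀ f₀ - R' f')) = t at *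
  generalize hn0 : Real.sqrt (trIP (fun _ => (1 : ℝ)) f₀ f₀) = n0 at *
  generalize hn1 : Real.sqrt (trIP (fun _ => (1 : ℝ)) (f₀ - f') (f₀ - f')) = n1 at *
  generalize hc : Real.sqrt (trIP (fun _ => (1 : ℝ)) C C) = c at *
  generalize hE : Real.sqrt (trIP (fun _ => (1 : ℝ)) C (deltaACubeY i q (parSymY i) (parBY i) (fun _ _ => 1 : CfgY (Matrix (Fin N) (Fin N) ℂ) i) C)) = e at *
  generalize hk : Real.sqrt ((d + 1 : ℝ) * i.cf ^ 2) = k at *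
  -- now: `a² = ‖R₀f₀‖²`, `b² = ‖R′f′‖²`
  have haa : trIP (fun _ => (1 : ℝ)) (R₀ f₀) (R₀ f₀) = a ^ 2 := by rw [← ha, Real.sq_sqrt ha0]
  have hbb : trIP (fun _ => (1 : ℝ)) (R' f') (R' f') = b ^ 2 := by rw [← hb, Real.sq_sqrt hb0]
  rw [haa, hbb]
  have hapos : 0 ≤ a := by rw [← ha]; exact Real.sqrt_nonneg _
  have h1 : a ^ 2 - b ^ 2 ≤ 2 * a * (a - b) := sq_sub_sq_le a b
  have h2 : a - b ≤ σ * n0 + n1 := by linarith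
  have h3 : σ * n0 + n1 ≤ 2 * k * (σ + ρ) * c := by
    have := mul_le_mul_of_nonneg_left hf0 hσ0
    nlinarith [this, hf1]
  have h4 : 2 * a * (a - b) ≤ 2 * a * (2 * k * (σ + ρ) * c) := mul_le_mul_of_nonneg_left (h2.trans h3) (by positivity)
  have h5 : 0 ≤ 2 * k * (σ + ρ) * c := by
    have hk0 : 0 ≤ k := by rw [← hk]; exact Real.sqrt_nonneg _
    have hc0' : 0 ≤ c := by rw [← hc]; exact Real.sqrt_nonneg _
    positivity
  have h6 : 2 * a * (2 * k * (σ + ρ) * c) ≤ 2 * e * (2 * k * (σ + ρ) * c) :=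
    mul_le_mul_of_nonneg_right (by linarith) h5
  calc a ^ 2 - b ^ 2 ≤ 2 * e * (2 * k * (σ + ρ) * c) := by linarith
    _ = 4 * k * (σ + ρ) * c * e := by ring

end Projection

end

end Literature.MathematicalPhysics.QuantumFieldTheory.Balaban1983to89.B9Eq377CubeLettersProjection
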